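import Literature.NumberTheory.Sieve.PairRoughCount
import HarnessLib

/-!
# Pairs of rough numbers, negative sign: `#{n ≤ N : (n(h−n), P(z)) = 1} ≪ (h/φ(h)) N/log² z` (`N < h`)

Topic `Literature/NumberTheory/Sieve`. Everything in this file is PROVED; no definition is introduced.
Sibling of `PairRoughCount.lean` (the polynomial `X(X + h)`): the same two-dimensional upper-bound
sieve for the Goldbach-type polynomial `g_h = X(h − X)`, `h` even, on `1 ≤ n ≤ N < h`, from the
tree's Fundamental Lemma for polynomial sequences (`abs_card_coprime_sub_le`, dimension `2`):

* `polyRootCountMod_pairPolyNeg` — `ω_{g_h}(p) = ω_{f_h}(p) = 1 + [p ∤ h]` (the roots of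
  `n(h − n) ≡ 0 (mod p)` are `0` and `h`);
* `card_pair_rough_le_neg` — for even `h`, `1 ≤ N < h` and `2 ≤ z ≤ √N`:
  `#{1 ≤ n ≤ N : (n, P(z)) = 1, (h − n, P(z)) = 1} ≤ C (h/φ(h)) N/log² z` with an absolute `C`
  (the density bound `prod_one_sub_pairRootCount_le` of the sibling file is reused through
  `ω_{g_h} = ω_{f_h}`).

This is the case `m₁ = m₂ = 0` of Matomäki–Merikoski's Lemma 3.1 (i) with the `−` sign
(arXiv:2112.11412; used for `Λ(n)Λ(h − n)`, `X ≤ h/4`, in §7).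

## References

* K. Matomäki, J. Merikoski, IMRN 2023 (arXiv:2112.11412), Lemma 3.1 (i) (case `m₁ = m₂ = 0`) and §7.
  [cite: MatomakiMerikoski2023, Lemma 3.1 (i)]
* H. Halberstam, H.-E. Richert, *Sieve Methods* (1974), Thm 2.5 (Fundamental Lemma).
  [cite: HalberstamRichert1974, Thm 2.5]
-/

noncomputable section

open Finset Real Polynomial

namespace Literature.NumberTheory.Sieve

namespace PairRough

/-! ### The root count of `X(h − X)` -/

/-- **`ω_{X(h−X)}(p) = 1 + [p ∤ h]`** at a prime `p`: the solutions of `n(h − n) ≡ 0 (mod p)` are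
`n ≡ 0` and `n ≡ h`, which coincide iff `p ∣ h`. [folklore] -/
theorem polyRootCountMod_pairPolyNeg (h : ℕ) {p : ℕ} (hp : p.Prime) :
    polyRootCountMod ![(X * (C (h : ℤ) - X) : ℤ[X])] p = if p ∣ h then 1 else 2 := by
  haveI := Fact.mk hp
  unfold polyRootCountMod
  simp only [Fin.prod_univ_one, Matrix.cons_val_zero, eval_mul, eval_X, eval_sub, eval_C]
  have hcast : ∀ n : ℕ, ((p : ℤ) ∣ (n : ℤ) * ((h : ℤ) - (n : ℤ))) ↔
      ((n : ZMod p) * ((h : ZMod p) - (n : ZMod p)) = 0) := by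
    intro n
    rw [← ZMod.intCast_zmod_eq_zero_iff_dvd]
    push_cast
    rfl
  simp_rw [hcast]
  have hval : ∀ n < p, ((n : ZMod p)).val = n := fun n hn => ZMod.val_natCast_of_lt hn
  split_ifs with hpk
  · have hk0 : (h : ZMod p) = 0 := (ZMod.natCast_eq_zero_iff h p).mpr hpk
    have hset : (range p).filter
        (fun n : ℕ => (n : ZMod p) * ((h : ZMod p) - (n : ZMod p)) = 0) = {0} := by
      ext n
      simp only [mem_filter, mem_range, mem_singleton, hk0, zero_sub, mul_neg, neg_eq_zero, mul_self_eq_zero]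
      constructor
      · rintro ⟨hn, h0⟩
        rw [← hval n hn, h0, ZMod.val_zero]
      · rintro rfl
        exact ⟨hp.pos, Nat.cast_zero⟩
    rw [hset, card_singleton]
  · have hk0 : (h : ZMod p) ≠ 0 := by rwa [Ne, ZMod.natCast_eq_zero_iff]
    set r : ZMod p := (h : ZMod p) with hr
    have hr0 : r.val ≠ 0 := by
      rw [Ne, ZMod.val_eq_zero, hr]
      exact hk0
    have hset : (range p).filter
        (fun n : ℕ => (n : ZMod p) * ((h : ZMod p) - (n : ZMod p)) = 0) = {0, r.val} := by
      ext n
      simp only [mem_filter, mem_range, mem_insert, mem_singleton, mul_eq_zero]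
      constructor
      · rintro ⟨hn, h0 | h0⟩
        · left
          rw [← hval n hn, h0, ZMod.val_zero]
        · right
          rw [← hval n hn]
          congr 1
          rw [hr]
          linear_combination -h0
      · rintro (rfl | rfl)
        · exact ⟨hp.pos, Or.inl Nat.cast_zero⟩
        · refine ⟨ZMod.val_lt r, Or.inr ?_⟩
          rw [ZMod.natCast_zmod_val, hr, sub_self]
    rw [hset, card_pair (Ne.symm hr0)]

/-- `ω_{X(h−X)} = ω_{X(X+h)}` at primes, `ω(2) ≤ 1` for even `h`, `ω(p) ≤ 2`. [folklore] -/
theorem pairPolyNeg_rootCount_bounds {h : ℕ} (hh : Even h) :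
    polyRootCountMod ![(X * (C (h : ℤ) - X) : ℤ[X])] 2 ≤ 1 ∧
      (∀ p : ℕ, p.Prime → polyRootCountMod ![(X * (C (h : ℤ) - X) : ℤ[X])] p ≤ 2) ∧
      ∀ p : ℕ, p.Prime → polyRootCountMod ![(X * (C (h : ℤ) - X) : ℤ[X])] p =
        polyRootCountMod ![(X * (X + C (h : ℤ)) : ℤ[X])] p := by
  refine ⟨?_, fun p hp => ?_, fun p hp => ?_⟩
  · rw [polyRootCountMod_pairPolyNeg h Nat.prime_two, if_pos (even_iff_two_dvd.mp hh)]
  · rw [polyRootCountMod_pairPolyNeg h hp]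
    split_ifs <;> norm_num
  · rw [polyRootCountMod_pairPolyNeg h hp, polyRootCountMod_pairPoly h hp]

/-! ### The pair count -/

/-- **Pairs of rough numbers, `−` sign** (Matomäki–Merikoski Lemma 3.1 (i), case `m₁ = m₂ = 0`,
`w₁ = w₂ = z`, negative sign): there is an absolute `C` such that for even `h`, `1 ≤ N < h` and
`2 ≤ z ≤ √N`, `#{1 ≤ n ≤ N : (n, P(z)) = 1 ∧ (h − n, P(z)) = 1} ≤ C (h/φ(h)) N/log² z`.
Proof: as `card_pair_rough_le`, for the polynomial sequence `{n(h − n) : n ≤ N}`.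
[cite: MatomakiMerikoski2023, Lemma 3.1 (i)] -/
theorem card_pair_rough_le_neg : ∃ C : ℝ, 0 < C ∧ ∀ h : ℕ, Even h → ∀ N : ℕ, 1 ≤ N → N < h → ∀ z : ℝ,
    2 ≤ z → z ^ 2 ≤ (N : ℝ) →
    (#((Ioc 0 N).filter fun n : ℕ => n.Coprime (primesProdBelow z) ∧ (h - n).Coprime (primesProdBelow z)) : ℝ) ≤
      C * ((h : ℝ) / (Nat.totient h : ℝ)) * N / (Real.log z) ^ 2 := by
  set Cω : ℝ := SieveSequence.flConst 2 (2 * Real.exp (17 + 12 / Real.log 2)) with hCω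
  have hCω0 : 0 < Cω := SieveSequence.flConst_pos (by norm_num) (by positivity)
  refine ⟨1 + Cω + 256 * Real.exp 8, by positivity, ?_⟩
  intro h hh N hN1 hNh z hz hzN
  have hh1 : 1 ≤ h := by omega
  set f : ℤ[X] := X * (C (h : ℤ) - X) with hf
  obtain ⟨h2, hle, hωeq⟩ := pairPolyNeg_rootCount_bounds hh
  have hz1 : 1 < z := by linarith
  have hz0 : 0 < z := by linarith
  have hN1 : (1 : ℝ) < N := by nlinarith
  have hN0 : (0 : ℝ) < N := by linarith
  have hlog : 0 < Real.log z := Real.log_pos hz1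
  -- identify the filter with the polynomial one
  have heval : ∀ n ∈ Ioc 0 N, f.eval (n : ℤ) = ((n * (h - n) : ℕ) : ℤ) := by
    intro n hn
    have hnh : n ≤ h := by have := (mem_Ioc.mp hn).2; omega
    rw [hf]; push_cast [Nat.cast_sub hnh]; simp
  have hfilter : ((Ioc 0 N).filter fun n : ℕ => n.Coprime (primesProdBelow z) ∧ (h - n).Coprime (primesProdBelow z)) =
      (Ioc 0 N).filter fun n : ℕ => (f.eval (n : ℤ)).natAbs.Coprime (primesProdBelow z) := by
    refine Finset.filter_congr fun n hn => ?_
    rw [heval n hn, Int.natAbs_natCast, Nat.coprime_mul_iff_left]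
  -- the two-sided Fundamental Lemma at level `D = √N`
  have hzD : z ≤ Real.sqrt N := by
    rw [Real.le_sqrt hz0.le hN0.le]; exact hzN
  have hx : ∀ n ∈ Ioc 0 N, 0 < f.eval (n : ℤ) ∧ ((f.eval (n : ℤ) : ℤ) : ℝ) ≤ (N : ℝ) * h := by
    intro n hn
    obtain ⟨hn0, hnN⟩ := mem_Ioc.mp hn
    rw [heval n hn]
    constructor
    · have : 0 < n * (h - n) := Nat.mul_pos hn0 (by omega)
      exact_mod_cast this
    · have h1 : (n : ℝ) ≤ N := by exact_mod_cast hnN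
      have hsub : ((h - n : ℕ) : ℝ) ≤ h := by exact_mod_cast Nat.sub_le h n
      have h2 : ((n * (h - n) : ℕ) : ℝ) = (n : ℝ) * ((h - n : ℕ) : ℝ) := by push_cast; ring
      rw [show (((n * (h - n) : ℕ) : ℤ) : ℝ) = ((n * (h - n) : ℕ) : ℝ) by norm_cast, h2]
      have hn0' : (0 : ℝ) ≤ n := Nat.cast_nonneg n
      have hh0 : (0 : ℝ) ≤ ((h - n : ℕ) : ℝ) := Nat.cast_nonneg _
      exact mul_le_mul h1 hsub hh0 (Nat.cast_nonneg N)
  have hFL := abs_card_coprime_sub_le h2 hle (N := N) hz hzD hx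
  rw [← hfilter] at hFL
  set V : ℝ := ∏ p ∈ Nat.primesBelow ⌈z⌉₊, (1 - (polyRootCountMod ![f] p : ℝ) / p) with hV
  have hVeq : V = ∏ p ∈ Nat.primesBelow ⌈z⌉₊,
      (1 - (polyRootCountMod ![(X * (X + C (h : ℤ)) : ℤ[X])] p : ℝ) / p) := by
    refine Finset.prod_congr rfl fun p hp => ?_
    rw [hωeq p (Nat.prime_of_mem_primesBelow hp)]
  have hVle : V ≤ ((h : ℝ) / (Nat.totient h : ℝ)) / (Real.log z) ^ 2 := by
    rw [hVeq]; exact prod_one_sub_pairRootCount_le hh1 hz1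
  have hV0 : 0 ≤ V := by
    have := prod_one_sub_rootCount_pos h2 hle z
    exact this.le
  have hexp : Real.exp (-(Real.log (Real.sqrt N) / Real.log z)) ≤ 1 := by
    rw [Real.exp_le_one_iff, neg_nonpos]
    exact div_nonneg (Real.log_nonneg (by rw [Real.le_sqrt (by norm_num) hN0.le]; linarith)) hlog.le
  have herr : Real.sqrt N * (Real.exp 8 * Real.log z ^ 2) ≤ 256 * Real.exp 8 * N / (Real.log z) ^ 2 := by
    rw [le_div_iff₀ (by positivity)]
    have := sqrt_mul_log_pow_four_le hz1 hzN
    nlinarith [Real.exp_pos 8]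
  have htot1 : (1 : ℝ) ≤ (h : ℝ) / (Nat.totient h : ℝ) := by
    rw [le_div_iff₀ (by exact_mod_cast Nat.totient_pos.mpr hh1), one_mul]
    exact_mod_cast Nat.totient_le h
  have hmain := (abs_le.mp hFL).2
  -- assemble
  calc (#((Ioc 0 N).filter fun n : ℕ => n.Coprime (primesProdBelow z) ∧ (h - n).Coprime (primesProdBelow z)) : ℝ)
      ≤ N * V + Cω * N * V * Real.exp (-(Real.log (Real.sqrt N) / Real.log z)) +
          Real.sqrt N * (Real.exp 8 * Real.log z ^ 2) := by linarith
    _ ≤ N * V + Cω * N * V + 256 * Real.exp 8 * N / (Real.log z) ^ 2 := by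
        have : Cω * N * V * Real.exp (-(Real.log (Real.sqrt N) / Real.log z)) ≤ Cω * N * V :=
          mul_le_of_le_one_right (by positivity) hexp
        linarith
    _ ≤ (1 + Cω) * N * (((h : ℝ) / (Nat.totient h : ℝ)) / (Real.log z) ^ 2) + 256 * Real.exp 8 * N / (Real.log z) ^ 2 := by
        have : (1 + Cω) * N * V ≤ (1 + Cω) * N * (((h : ℝ) / (Nat.totient h : ℝ)) / (Real.log z) ^ 2) :=
          mul_le_mul_of_nonneg_left hVle (by positivity)
        linarith
    _ = ((1 + Cω) * ((h : ℝ) / (Nat.totient h : ℝ)) + 256 * Real.exp 8) * N / (Real.log z) ^ 2 := by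
        field_simp
    _ ≤ (1 + Cω + 256 * Real.exp 8) * ((h : ℝ) / (Nat.totient h : ℝ)) * N / (Real.log z) ^ 2 := by
        refine div_le_div_of_nonneg_right (mul_le_mul_of_nonneg_right ?_ hN0.le) (by positivity)
        nlinarith [Real.exp_pos 8, htot1, hCω0]

end PairRough

end Literature.NumberTheory.Sieve
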